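import Summits.Parity.GeneralizedHardyLittlewood.Theses.LiouvilleShiftedTables
import Summits.Parity.GeneralizedHardyLittlewood.Theorems.DilatedTableChowla.Negative.DilatedTableChowlaPointwise

/-!
# `LargeDilatedTableChowla` (stmt-Parity-14839): prover interface — pointwise bound off a sparse set of band dilations

Support file for the item `LiouvilleShiftedTables.LargeDilatedTableChowla` (route
LiouvilleShiftedTables, support r9; notation `F`, `rows`, `cols` of
`Theorems/DilatedTableChowla/Negative/DilatedTableChowlaBlocks`).  The item asks, for every `c ≠ 0`,
`0 < δ ≤ 1/12`, `C > 0`, for `K`, `x₀` with `Σ_{(log x)^K < q ≤ x^{δ/2}} q³ · F(q,u q,v q) ≤ x²/(log x)^C`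
(`x ≥ x₀`, uniformly in the window `A` and the classes).  Here it is shown EQUIVALENT to its
pointwise-generic form (`item_iff_bandPointwise`): for every `(c,δ,C)` there are `K`, `x₀` such that
for all `x ≥ x₀`, `A`, `u`, `v` there is an exceptional set `E'` of dilations with
`Σ_{q∈E'} 1/q ≤ (log x)^{-C}` and `q⁴ · F(q,u q,v q) ≤ x²/(log x)^C` for every band dilation
`(log x)^K < q ≤ x^{δ/2}` outside `E'` — a `(log x)^C` saving over the trivial `≍ x²/q⁴` for each
generic block.  Necessity is Markov's inequality on the harmonic average
(`markov_harmonic_of_sum_le`, `item_imp_bandPointwise`); sufficiency (`bandPointwise_imp_item`) pays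
the exceptional set with the trivial bound `q³F ≤ 36 x²/q` (`Negative.window_counts`,
`Negative.F_le_trivial`) and the generic dilations with `Σ_{q ≤ x^{δ/2}} 1/q ≤ 1 + log x`.  This is the
shape a large-sieve-in-`q` / dispersion argument would deliver, with the multiples of a
Siegel-exceptional conductor `q₁ > (log x)^{C+2}` parked in `E'` (`Negative.multiples_admissible`) and
smaller conductors below the threshold once `K ≥ C + 2`. [folklore]
-/

namespace Summit.Parity.GeneralizedHardyLittlewood.Theorems.LargeDilatedTableChowla

open Finset
open Summit.Parity.GeneralizedHardyLittlewood.Theses.LiouvilleShiftedTables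
open Summit.Parity.GeneralizedHardyLittlewood.Theorems.DilatedTableChowla.Negative

/-! ### Prover interface: pointwise bound off a harmonically sparse set of band dilations -/

/-- MARKOV ON THE HARMONIC AVERAGE over an arbitrary set `s` of positive dilations: if
`Σ_{q ∈ s} q³ G(q) ≤ T` with `G ≥ 0`, the `q ∈ s` with `q⁴ G(q) > X` have harmonic mass `≤ T/X`.
[folklore] -/
theorem markov_harmonic_of_sum_le {s : Finset ℕ} (hs : ∀ q ∈ s, 1 ≤ q) {G : ℕ → ℝ}
    (hG : ∀ q, 0 ≤ G q) {X T : ℝ} (hX : 0 < X) (hsum : ∑ q ∈ s, (q : ℝ) ^ 3 * G q ≤ T) :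
    ∑ q ∈ s.filter (fun q : ℕ => X < (q : ℝ) ^ 4 * G q), ((q : ℝ))⁻¹ ≤ T / X := by
  have hT : ∑ q ∈ s, (q : ℝ) ^ 3 * G q * X⁻¹ ≤ T / X := by
    rw [← Finset.sum_mul, div_eq_mul_inv]
    exact mul_le_mul_of_nonneg_right hsum (inv_nonneg.2 hX.le)
  refine le_trans ?_ (le_trans (Finset.sum_le_sum_of_subset_of_nonneg
    (Finset.filter_subset (fun q : ℕ => X < (q : ℝ) ^ 4 * G q) _)
    fun q _ _ => by have := hG q; positivity) hT)
  refine Finset.sum_le_sum fun q hq => ?_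
  obtain ⟨hqs, hlt⟩ := Finset.mem_filter.1 hq
  have hq1 : (1 : ℝ) ≤ q := by exact_mod_cast hs q hqs
  have hqpos : (0 : ℝ) < q := by linarith
  calc ((q : ℝ))⁻¹ = ((q : ℝ))⁻¹ * X * X⁻¹ := by field_simp
    _ ≤ ((q : ℝ))⁻¹ * ((q : ℝ) ^ 4 * G q) * X⁻¹ := by gcongr
    _ = (q : ℝ) ^ 3 * G q * X⁻¹ := by field_simp

/-- NECESSITY (Markov): the item at exponent `2C` gives, for the same threshold `K`, an exceptional
set `E'` of band dilations of harmonic mass `≤ (log x)^{-C}` off which the POINTWISE block bound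
`q⁴ F(q,u q,v q) ≤ x²/(log x)^C` holds. [folklore] -/
theorem item_imp_bandPointwise (h : LargeDilatedTableChowla) :
    ∀ c : ℤ, c ≠ 0 → ∀ δ : ℝ, 0 < δ → δ ≤ 1 / 12 → ∀ C : ℝ, 0 < C → ∃ K : ℕ, ∃ x₀ : ℝ,
      ∀ x : ℝ, x₀ ≤ x → ∀ A : ℝ, x ^ δ ≤ A → A ≤ x ^ (1 / 3 + δ) → ∀ u v : ℕ → ℕ,
        ∃ E' : Finset ℕ, (∑ q ∈ E', ((q : ℝ))⁻¹) ≤ (Real.log x ^ C)⁻¹ ∧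
          ∀ q : ℕ, ⌊Real.log x ^ K⌋₊ < q → q ≤ ⌊x ^ (δ / 2)⌋₊ → q ∉ E' →
            (q : ℝ) ^ 4 * F c x A q (u q) (v q) ≤ x ^ 2 / Real.log x ^ C := by
  intro c hc δ hδ hδ' C hC
  obtain ⟨K, x₀, hx₀⟩ := h c hc δ hδ hδ' (C + C) (by linarith)
  refine ⟨K, max x₀ 3, fun x hx A hA1 hA2 u v => ?_⟩
  have hx0 : x₀ ≤ x := le_trans (le_max_left _ _) hx
  have hx3 : (3 : ℝ) ≤ x := le_trans (le_max_right _ _) hx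
  have hlog : 0 < Real.log x := Real.log_pos (by linarith)
  have hLC : 0 < Real.log x ^ C := Real.rpow_pos_of_pos hlog C
  have hX : 0 < x ^ 2 / Real.log x ^ C := by positivity
  have hsum := hx₀ x hx0 A hA1 hA2 u v
  set s := Finset.Ioc ⌊Real.log x ^ K⌋₊ ⌊x ^ (δ / 2)⌋₊ with hs
  have hs1 : ∀ q ∈ s, 1 ≤ q := fun q hq => by
    rw [hs, Finset.mem_Ioc] at hq; omega
  refine ⟨s.filter (fun q : ℕ => x ^ 2 / Real.log x ^ C < (q : ℝ) ^ 4 * F c x A q (u q) (v q)),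
    ?_, fun q hq1 hq2 hqE => ?_⟩
  · refine (markov_harmonic_of_sum_le hs1 (fun q => F_nonneg c x A q (u q) (v q)) hX hsum).trans_eq
      ?_
    have hLCne : Real.log x ^ C ≠ 0 := hLC.ne'
    have hxne : x ≠ 0 := (by linarith : (0 : ℝ) < x).ne'
    rw [Real.rpow_add hlog C C]
    field_simp
  · by_contra hlt
    exact hqE (Finset.mem_filter.2 ⟨by rw [hs, Finset.mem_Ioc]; exact ⟨hq1, hq2⟩, lt_of_not_ge hlt⟩)

/-- SUFFICIENCY: the pointwise block bound off a harmonically sparse exceptional set of band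
dilations, at exponent `C+2` and threshold `K`, gives the item at exponent `C` with the same `K`:
on `E'` the trivial bound `q³ F ≤ 36 x²/q` (`Negative.window_counts`, `Negative.F_le_trivial`)
costs `36 x² Σ_{q∈E'} 1/q ≤ 36 x²/(log x)^{C+2}`, off `E'` the pointwise bound costs
`(Σ_{q ≤ x^{δ/2}} 1/q) · x²/(log x)^{C+2} ≤ (1 + log x) x²/(log x)^{C+2}`, and
`37 + log x ≤ (log x)²` for `log x ≥ 7`. [folklore] -/
theorem bandPointwise_imp_item
    (h : ∀ c : ℤ, c ≠ 0 → ∀ δ : ℝ, 0 < δ → δ ≤ 1 / 12 → ∀ C : ℝ, 0 < C → ∃ K : ℕ, ∃ x₀ : ℝ,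
      ∀ x : ℝ, x₀ ≤ x → ∀ A : ℝ, x ^ δ ≤ A → A ≤ x ^ (1 / 3 + δ) → ∀ u v : ℕ → ℕ,
        ∃ E' : Finset ℕ, (∑ q ∈ E', ((q : ℝ))⁻¹) ≤ (Real.log x ^ C)⁻¹ ∧
          ∀ q : ℕ, ⌊Real.log x ^ K⌋₊ < q → q ≤ ⌊x ^ (δ / 2)⌋₊ → q ∉ E' →
            (q : ℝ) ^ 4 * F c x A q (u q) (v q) ≤ x ^ 2 / Real.log x ^ C) :
    LargeDilatedTableChowla := by
  intro c hc δ hδ hδ' C hC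
  obtain ⟨K, x₀, hx₀⟩ := h c hc δ hδ hδ' (C + 2) (by linarith)
  refine ⟨K, max x₀ (Real.exp 7), fun x hx A hA1 hA2 u v => ?_⟩
  have hx0 : x₀ ≤ x := le_trans (le_max_left _ _) hx
  have hxe : Real.exp 7 ≤ x := le_trans (le_max_right _ _) hx
  have hlog7 : (7 : ℝ) ≤ Real.log x := (Real.le_log_iff_exp_le ((Real.exp_pos 7).trans_le hxe)).2 hxe
  have hlogpos : 0 < Real.log x := by linarith
  have hx1 : (1 : ℝ) ≤ x := le_trans (by have := Real.add_one_le_exp (7 : ℝ); linarith) hxe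
  have hxpos : 0 < x := by linarith
  have hLC : 0 < Real.log x ^ C := Real.rpow_pos_of_pos hlogpos C
  have hLC2 : 0 < Real.log x ^ (C + 2) := Real.rpow_pos_of_pos hlogpos _
  obtain ⟨E, hE, hpt⟩ := hx₀ x hx0 A hA1 hA2 u v
  set Q : ℕ := ⌊x ^ (δ / 2)⌋₊ with hQdef
  set m : ℕ := ⌊Real.log x ^ K⌋₊ with hmdef
  have hsplit := Finset.sum_filter_add_sum_filter_not (Finset.Ioc m Q) (fun q => q ∈ E)
    (fun q => (q : ℝ) ^ 3 * F c x A q (u q) (v q))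
  -- (a) exceptional dilations: trivial bound `q³ F ≤ 36 x²/q`
  have hexc : ∑ q ∈ (Finset.Ioc m Q).filter (fun q => q ∈ E), (q : ℝ) ^ 3 * F c x A q (u q) (v q)
      ≤ 36 * x ^ 2 * ∑ q ∈ E, ((q : ℝ))⁻¹ := by
    calc ∑ q ∈ (Finset.Ioc m Q).filter (fun q => q ∈ E), (q : ℝ) ^ 3 * F c x A q (u q) (v q)
        ≤ ∑ q ∈ (Finset.Ioc m Q).filter (fun q => q ∈ E), 36 * x ^ 2 * ((q : ℝ))⁻¹ := by
          refine Finset.sum_le_sum fun q hq => ?_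
          obtain ⟨hq, -⟩ := Finset.mem_filter.1 hq
          obtain ⟨hqm, hq2⟩ := Finset.mem_Ioc.1 hq
          have hq1 : 1 ≤ q := by omega
          have hqpos : (0 : ℝ) < q := by exact_mod_cast hq1
          obtain ⟨hr, hcl, -, -, -, h1A⟩ := window_counts hδ hδ' hx1 hA1 hA2 hq1 hq2 (u q) (v q)
          have hApos : 0 < A := by linarith
          have hF := F_le_trivial c x A q (u q) (v q)
          calc (q : ℝ) ^ 3 * F c x A q (u q) (v q)
              ≤ (q : ℝ) ^ 3 * ((3 * A / q) ^ 2 * (2 * x / (A * q)) ^ 2) := by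
                gcongr
                exact hF.trans (by gcongr)
            _ = 36 * x ^ 2 * ((q : ℝ))⁻¹ := by field_simp; ring
      _ ≤ ∑ q ∈ E, 36 * x ^ 2 * ((q : ℝ))⁻¹ :=
          Finset.sum_le_sum_of_subset_of_nonneg (fun q hq => (Finset.mem_filter.1 hq).2)
            fun q _ _ => by positivity
      _ = 36 * x ^ 2 * ∑ q ∈ E, ((q : ℝ))⁻¹ := by rw [Finset.mul_sum]
  -- (b) generic band dilations: the pointwise hypothesis and the harmonic sum
  have hgen : ∑ q ∈ (Finset.Ioc m Q).filter (fun q => ¬ q ∈ E), (q : ℝ) ^ 3 * F c x A q (u q) (v q)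
      ≤ (1 + Real.log Q) * (x ^ 2 / Real.log x ^ (C + 2)) := by
    calc ∑ q ∈ (Finset.Ioc m Q).filter (fun q => ¬ q ∈ E), (q : ℝ) ^ 3 * F c x A q (u q) (v q)
        ≤ ∑ q ∈ (Finset.Ioc m Q).filter (fun q => ¬ q ∈ E),
            ((q : ℝ))⁻¹ * (x ^ 2 / Real.log x ^ (C + 2)) := by
          refine Finset.sum_le_sum fun q hq => ?_
          obtain ⟨hq, hqE⟩ := Finset.mem_filter.1 hq
          obtain ⟨hqm, hq2⟩ := Finset.mem_Ioc.1 hq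
          have hq1 : 1 ≤ q := by omega
          have hqpos : (0 : ℝ) < q := by exact_mod_cast hq1
          have hp := hpt q hqm hq2 hqE
          calc (q : ℝ) ^ 3 * F c x A q (u q) (v q)
              = ((q : ℝ))⁻¹ * ((q : ℝ) ^ 4 * F c x A q (u q) (v q)) := by field_simp
            _ ≤ ((q : ℝ))⁻¹ * (x ^ 2 / Real.log x ^ (C + 2)) := by gcongr
      _ ≤ ∑ q ∈ Finset.Icc 1 Q, ((q : ℝ))⁻¹ * (x ^ 2 / Real.log x ^ (C + 2)) := by
          refine Finset.sum_le_sum_of_subset_of_nonneg ?_ fun q _ _ => by positivity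
          intro q hq
          have hq' := (Finset.mem_filter.1 hq).1
          rw [Finset.mem_Ioc] at hq'
          exact Finset.mem_Icc.2 ⟨by omega, hq'.2⟩
      _ = (∑ q ∈ Finset.Icc 1 Q, ((q : ℝ))⁻¹) * (x ^ 2 / Real.log x ^ (C + 2)) := by
          rw [Finset.sum_mul]
      _ ≤ (1 + Real.log Q) * (x ^ 2 / Real.log x ^ (C + 2)) := by
          gcongr; exact harmonic_Icc_le Q
  -- (c) numerics
  have hxd2 : 0 < x ^ (δ / 2) := Real.rpow_pos_of_pos hxpos _
  have hlogQ : Real.log Q ≤ Real.log x := by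
    rcases Nat.eq_zero_or_pos Q with h0 | hQpos
    · rw [h0, Nat.cast_zero, Real.log_zero]; exact hlogpos.le
    · have hQle : (Q : ℝ) ≤ x := by
        calc (Q : ℝ) ≤ x ^ (δ / 2) := Nat.floor_le hxd2.le
          _ ≤ x ^ (1 : ℝ) := Real.rpow_le_rpow_of_exponent_le hx1 (by linarith)
          _ = x := Real.rpow_one x
      exact Real.log_le_log (by exact_mod_cast hQpos) hQle
  have hpow : Real.log x ^ (C + 2) = Real.log x ^ C * Real.log x ^ 2 := by
    rw [Real.rpow_add hlogpos, Real.rpow_two]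
  have hkey : (1 + Real.log Q) * (x ^ 2 / Real.log x ^ (C + 2)) + 36 * x ^ 2 * (Real.log x ^ (C + 2))⁻¹
      ≤ x ^ 2 / Real.log x ^ C := by
    rw [hpow]
    have hL2 : 0 < Real.log x ^ 2 := by positivity
    calc (1 + Real.log Q) * (x ^ 2 / (Real.log x ^ C * Real.log x ^ 2)) +
          36 * x ^ 2 * (Real.log x ^ C * Real.log x ^ 2)⁻¹
        = (37 + Real.log Q) * x ^ 2 / (Real.log x ^ C * Real.log x ^ 2) := by
          field_simp; ring
      _ ≤ (37 + Real.log x) * x ^ 2 / (Real.log x ^ C * Real.log x ^ 2) := by gcongr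
      _ ≤ Real.log x ^ 2 * x ^ 2 / (Real.log x ^ C * Real.log x ^ 2) := by
          gcongr
          nlinarith
      _ = x ^ 2 / Real.log x ^ C := by field_simp
  have hexc' : 36 * x ^ 2 * ∑ q ∈ E, ((q : ℝ))⁻¹ ≤ 36 * x ^ 2 * (Real.log x ^ (C + 2))⁻¹ := by
    gcongr
  calc (∑ q ∈ Finset.Ioc m Q, (q : ℝ) ^ 3 * F c x A q (u q) (v q))
      = (∑ q ∈ (Finset.Ioc m Q).filter (fun q => q ∈ E), (q : ℝ) ^ 3 * F c x A q (u q) (v q)) +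
          ∑ q ∈ (Finset.Ioc m Q).filter (fun q => ¬ q ∈ E), (q : ℝ) ^ 3 * F c x A q (u q) (v q) :=
        hsplit.symm
    _ ≤ 36 * x ^ 2 * (Real.log x ^ (C + 2))⁻¹ + (1 + Real.log Q) * (x ^ 2 / Real.log x ^ (C + 2)) :=
        add_le_add (hexc.trans hexc') hgen
    _ ≤ x ^ 2 / Real.log x ^ C := by linarith

/-- **PROVER INTERFACE: `LargeDilatedTableChowla ↔` pointwise-off-sparse in the band.** The item is
EQUIVALENT to: for every `c ≠ 0`, `0 < δ ≤ 1/12`, `C > 0` there are `K`, `x₀` such that for `x ≥ x₀`,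
every `A` in the window and all class functions `u v` there is an exceptional set `E'` of dilations
of harmonic mass `Σ_{q∈E'} 1/q ≤ (log x)^{-C}` with `q⁴ · F(q,u q,v q) ≤ x²/(log x)^C` for every band
dilation `(log x)^K < q ≤ x^{δ/2}` outside `E'` — a `(log x)^C` saving over the trivial `≍ x²/q⁴`
for each generic block (the shape a large-sieve-in-`q` / dispersion argument would deliver, with the
Siegel-exceptional multiples parked in `E'`, cf. `Negative.multiples_admissible`). [folklore] -/
theorem item_iff_bandPointwise : LargeDilatedTableChowla ↔
    ∀ c : ℤ, c ≠ 0 → ∀ δ : ℝ, 0 < δ → δ ≤ 1 / 12 → ∀ C : ℝ, 0 < C → ∃ K : ℕ, ∃ x₀ : ℝ,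
      ∀ x : ℝ, x₀ ≤ x → ∀ A : ℝ, x ^ δ ≤ A → A ≤ x ^ (1 / 3 + δ) → ∀ u v : ℕ → ℕ,
        ∃ E' : Finset ℕ, (∑ q ∈ E', ((q : ℝ))⁻¹) ≤ (Real.log x ^ C)⁻¹ ∧
          ∀ q : ℕ, ⌊Real.log x ^ K⌋₊ < q → q ≤ ⌊x ^ (δ / 2)⌋₊ → q ∉ E' →
            (q : ℝ) ^ 4 * F c x A q (u q) (v q) ≤ x ^ 2 / Real.log x ^ C :=
  ⟨item_imp_bandPointwise, bandPointwise_imp_item⟩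

end Summit.Parity.GeneralizedHardyLittlewood.Theorems.LargeDilatedTableChowla
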